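import Mathlib
import Summits.Ventures.PercRepro.PuncturedLYMTypeLiftNine
import Summits.Ventures.PercRepro.PuncturedLYMTypeLiftTen
import Summits.Ventures.PercRepro.PuncturedLYMTypeLiftEleven
import Summits.Ventures.PercRepro.PuncturedLYMTypeLiftTwelve
import Summits.Ventures.PercRepro.PuncturedLYMTypeLiftThirteen
import Summits.Ventures.PercRepro.PuncturedLYMTriplesSymMain

/-!
# PercRepro — (SP) FOR THREE PAIRWISE DISJOINT TRIPLES AT LEVEL 4 ON EVERY GROUND SET
(p10, gen 39)

THE THEOREM `puncturedNMP_three_triples`: for every finite type with at least `9` points and every three pairwise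
disjoint `3`-subsets, the punctured normalised matching property (SP) holds at level `4` for the `4`-sets containing none
of them — the first theorem of the MIXED-SIZE class of (SP) (three members of size `< j`) on every ground set: the
numeric type certificates for `n = 9, 10, 11, 12, 13` and the symbolic certificate for `n = m + 14`.  (`n ≥ 9` is forced:
the members occupy `9` points.)
-/

namespace PercRepro.PuncturedLYM.Split.TypeLift

open Finset

variable {α : Type} [DecidableEq α] [Fintype α]

/-- **THEOREM. (SP) for three pairwise disjoint triples at level `4`, on every ground set.** -/
theorem puncturedNMP_three_triples (C : Fin 3 → Finset α) (hcard : ∀ i, (C i).card = 3)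
    (hdisj : ∀ i l, i ≠ l → Disjoint (C i) (C l)) :
    PuncturedNMP 4 ((univ : Finset (Fin 3)).biUnion (fun i => upLevel 4 (C i))) := by
  have h9 : 9 ≤ Fintype.card α := by
    have := card_le_univ ((univ : Finset (Fin 3)).biUnion C)
    rw [card_biUnion (fun i _ l _ hil => hdisj i l hil)] at this
    simp only [hcard, sum_const, card_univ, Fintype.card_fin, smul_eq_mul] at this
    omega
  rcases Nat.lt_or_ge (Fintype.card α) 14 with hlt | hge
  · interval_cases hn : Fintype.card α
    · exact Nine.puncturedNMP_three_three_three_nine hn C hcard hdisj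
    · exact Ten.puncturedNMP_three_three_three_ten hn C hcard hdisj
    · exact Eleven.puncturedNMP_three_three_three_eleven hn C hcard hdisj
    · exact Twelve.puncturedNMP_three_three_three_twelve hn C hcard hdisj
    · exact Thirteen.puncturedNMP_three_three_three_thirteen hn C hcard hdisj
  · obtain ⟨m, hm⟩ : ∃ m, Fintype.card α = m + 14 := ⟨Fintype.card α - 14, by omega⟩
    exact TriplesSym.puncturedNMP_three_three_three_of_fourteen_le m hm C hcard hdisj

end PercRepro.PuncturedLYM.Split.TypeLift
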